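import Summits.CriticalPhenomena.PercolationContinuityZ3.Theorems.Transplant.KNCells2ChainBandROK
import Summits.CriticalPhenomena.PercolationContinuityZ3.Theorems.Transplant.KNCells2ChainBandRO
import HarnessLib

/-!
# Bridges between the two decoupled band records of the F-DP4-2 repair: `Band.BandROK` / `Band.scheduleR'` (p1-g10, `KNCells2ChainBandROK`,
# p253230 — consumed by the (F) column, hp-8 g30 p253798) and the FILE OF RECORD `Band.BandOKR` / `Band.scheduleRO` (p2-g8, `KNCells2ChainBandRO`,
# p253183 — consumed by (R) and (C)); design-owner ruling p3-g7 2026-08-21T06:55:18Z ("add the 4-line bridges if a consumer typed against the other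
# file"), lead g5 07:02:10Z

builds on p205010 (kernel theorem, internal audit signed; external expert review pending) — nothing in this file uses p205010.
Lane `prim-bschramm`, seat `prim-bschramm-p1` (gen 10; Band owner, defect desk); helper file (`--supports stmt-CriticalPhenomena-4575 --as helper`).
A separate leaf module rather than an append to `KNCells2ChainBandROK` because that file's five primed run lemmas are statement-twins of the
file of record's `…RO` lemmas and an append importing `KNCells2ChainBandRO` trips the gate's dedup lint (`dedup.landed`); here only the bridges
are declared.  The two records have the same six fields `hq hq' hs hs2 hρ hWM`; the two schedules are the same `ChainPlanar.Schedule` (`rfl`), so the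
params seat discharges the six fields ONCE (as `BandOKR`) and hands `(…).toROK` to the (F) column.
* `Band.BandROK.toOKR`, `Band.BandOKR.toROK`; `Band.scheduleR'_eq_scheduleRO`, `Band.scheduleRO_eq_scheduleR'` (both `rfl`).
[cite: KozmaNitzan2024, §4 Lemma 11 (pp. 22–23)]
-/

noncomputable section

namespace Summit.CriticalPhenomena.PercolationContinuityZ3.Theorems

namespace Transplant

namespace ChainPlanar

namespace Band

open Literature.Probability.Percolation Literature.Probability.LatticeModels

variable {q q' s₁ ρ : ℤ} {R' N WM ℓ₀ : ℕ} {Wb : ℕ → ℕ}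

/-- `BandROK → BandOKR` (same six fields; the record of record is `BandOKR`). [folklore] -/
theorem BandROK.toOKR (hR : BandROK q q' s₁ ρ R' ℓ₀ N WM Wb) : BandOKR q q' s₁ ρ R' ℓ₀ N WM Wb :=
  ⟨hR.hq, hR.hq', hR.hs, hR.hs2, hR.hρ, hR.hWM⟩

/-- `BandOKR → BandROK`. [folklore] -/
theorem BandOKR.toROK (hR : BandOKR q q' s₁ ρ R' ℓ₀ N WM Wb) : BandROK q q' s₁ ρ R' ℓ₀ N WM Wb :=
  ⟨hR.hq, hR.hq', hR.hs, hR.hs2, hR.hρ, hR.hWM⟩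

variable {a : Fin 2} {σ : ℤ} (hσ : σ = 1 ∨ σ = -1) (c : Site 2) {ℓ₁ : ℕ} (hℓ₁ : 2 * q + s₁ + R' ≤ ℓ₁)

/-- **The two decoupled rooted schedules are the same schedule** (`rfl`: identical data, proof fields irrelevant) — every fact proved about
p2-g8's `Band.scheduleRO` holds for `Band.scheduleR'` and conversely. [folklore] -/
theorem scheduleR'_eq_scheduleRO (a : Fin 2) (h : BandROK q q' s₁ ρ R' ℓ₀ N WM Wb) :
    scheduleR' a hσ c h hℓ₁ = scheduleRO hσ c a h.toOKR hℓ₁ := rfl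

/-- … and starting from a `BandOKR`. [folklore] -/
theorem scheduleRO_eq_scheduleR' (a : Fin 2) (hR : BandOKR q q' s₁ ρ R' ℓ₀ N WM Wb) :
    scheduleRO hσ c a hR hℓ₁ = scheduleR' a hσ c hR.toROK hℓ₁ := rfl

end Band

end ChainPlanar

end Transplant

end Summit.CriticalPhenomena.PercolationContinuityZ3.Theorems

end
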